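import Summits.QuantumFields.YangMills.Theorems.BalabanUVNodesN15CovariantLandauOnePropagatorKnitDefectRow
import HarnessLib

/-!
# N15 = NE2 — dag-n15-a g33, (♭-8c): THE (P-R) ONE-PROPAGATOR LITERAL, ALL FOUR OPERATOR ENTRIES CONCRETE, TRACE-FORM COORDINATES SUPPLIED — purely numeric hypotheses + the ONE displayed
# row (the two-grid η-defect row of `N_V^R`); pinned and existence forms
# (dag-n15-a g33, (♭-8c); node N15 = NE2; `--supports stmt-QuantumFields-27366 --as helper`, count-neutral; two theorems; imports (♭-8b))

WHY.  (♭-8b) `live_and_n15At_sfObjects₈qvr_wQ8D` still carries the abstract trace-form coordinates `e` with `he`.  As (𝟙P-f) `live_and_n15At_sfObjects₆qv_tf` did for the (P-Q) literal, this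
file supplies the canonical coordinates (`e := tfCoords mm`, `ι := Fin 2 × mm × mm`; dag-n15-a `…N15TraceFormCoordinates`), so that the lane's most print-faithful literal has NUMERIC
hypotheses only (`d ≥ 1`, odd `L ≥ 7`, `a, c₃₅ > 0`) plus n15-c∕234's one displayed row.

HONEST FRAMING ∕ LIMITS.  As (♭-8b): the two-grid η-defect row of `N_V^R` is a HYPOTHESIS (n15-c's located g24 object); MODEL carriers ∕ operators; NOT [Balaban1985BackgroundPropagators]
Thms 3.1 ∕ 3.2 ∕ 3.4 ∕ 3.14 ∕ 3.15 as printed; NE2⁺ NOT PRINTED; N15 stays DISCHARGED OF RECORD 8∕27 AS CONSUMED (p687738) — nothing re-claimed, no count moved; K3⁸ OPEN; finite 𝕋⁴ per index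
— NOT ℝ⁴ ∕ OS ∕ mass gap ∕ Clay.  No `sorry`, `instance`, `notation`; standard axioms.
-/

noncomputable section

open scoped BigOperators Matrix

namespace Summit.QuantumFields.YangMills.BalabanUVNodes.N15.SiteLayerSf

open Literature.MathematicalPhysics.QuantumFieldTheory.Balaban1983to89
open Literature.MathematicalPhysics.QuantumFieldTheory.Balaban1983to89.T4EtaRate (NE2PlusOperator NE2PlusSite NE2PlusUnit rateFactor)
open Literature.MathematicalPhysics.QuantumFieldTheory.Balaban1983to89.B11SectG (BlockNorm HasMaj)
open Literature.MathematicalPhysics.QuantumFieldTheory.Balaban1983to89.B5Prop11Plancherel (Tor fine)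
open Literature.MathematicalPhysics.QuantumFieldTheory.Balaban1983to89.B6UnitTorusCarrier (unitTorusGeo)
open Literature.MathematicalPhysics.QuantumFieldTheory.Balaban1983to89.T4EtaRateDefect (idef)
open Literature.MathematicalPhysics.QuantumFieldTheory.Balaban1983to89.T4EtaRateCoeffDefect (pull)
open Literature.MathematicalPhysics.QuantumFieldTheory.King1986.Torus (blockOf)
open Literature.Barriers.QuantumFields (traceForm)
open Summit.QuantumFields.YangMills.BalabanUVNodes.N15.BackgroundLayer (gavgM)
open Summit.QuantumFields.YangMills.BalabanUVNodes.N15.VectorPiece (bshiftEquiv kingPrV tensorId)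
open Summit.QuantumFields.YangMills.BalabanUVNodes.N15.MatrixSpecies (liftBlk liftMap)
open Summit.QuantumFields.YangMills.BalabanUVNodes.N15.TwoGrid (gOp)
open Summit.QuantumFields.YangMills.BalabanUVNodes.N15.Gluing (SfIdx sfGeo sfInstance sfFamily sfqrFamily sfqrEntry0 CvX CvX' cvM cvBlk CvNorm cvNL cvNL' cvGlued cvGlued' cvNVq cvNVq' cvNVr cvNVr'
  ne2PlusOperator_sfqr_of_global_small sfqrE₄ ne2PlusOperator_sfqr₄E landauRows_small_of_gradDiffRow landauRows_small_of_defectRow cvT₀)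
open Summit.QuantumFields.YangMills.BalabanUVNodes.N15.OperatorReadout (opGeo)
open Summit.QuantumFields.YangMills.BalabanUVNodes.N15.CovLandau (cgrad cGreen)
open Literature.MathematicalPhysics.QuantumFieldTheory.King1986 (aK)
open Summit.QuantumFields.YangMills.BalabanUVNodes.N15.PairedFamilyGuard (Live)
open Literature.MathematicalPhysics.QuantumFieldTheory.Balaban1983to89.T4Continuum (T4Family ULoop)
open Node00 (NE2Objects₁₁)
open Summit.QuantumFields.YangMills.BalabanUVNodes.N15.AtKeyedHome (s_N15_of_admits)
open YMDAG.UVSplit (Datum RateCarriers RateRecordPred N15At S_N15 ne2OfRecord₁₁)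


open scoped Matrix.Norms.L2Operator

variable (d : ℕ) {L : ℕ} [NeZero L] (mm : Type) [Fintype mm] [DecidableEq mm] [Nonempty mm] (a : ℝ)

section Tf

/-- ★★★★ **GUARD ∧ `N15At` AT THE (P-R) ONE-PROPAGATOR LITERAL, ALL FOUR OPERATOR ENTRIES CONCRETE, TRACE-FORM COORDINATES SUPPLIED** (`e := tfCoords mm`, `ι := Fin 2 × mm × mm`; (T-1)
`traceForm_eq_tfCoords_dotProduct` discharges `he`): the hypotheses are now purely NUMERIC (`d ≥ 1`, odd `L ≥ 7`, `a, c₃₅ > 0`) plus the ONE displayed row `hD` (the two-grid η-defect row of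
`N_V^R`, n15-c∕234's hypothesis at the trace-form coordinates).  = (♭-8b) `live_and_n15At_sfObjects₈qvr_wQ8D` at `e := tfCoords mm`.  MODEL carriers; NOT [B9] as printed.
[cite: Balaban1985BackgroundPropagators, Thm 3.1 (3.42) p.397, Thm 3.2 (3.47)–(3.48) p.398, Thm 3.15 (3.187) p.432 (templates: MODEL level), (3.49) p.399] -/
theorem live_and_n15At_sfObjects₈qvr_wQ8D_tf (hd : 1 ≤ d) (hL : Odd L ∧ 1 < L) (hL7 : 7 ≤ L) (ha : 0 < a) {c35 : ℝ} (hc35 : 0 < c35) (μ₁ μ₂ : Fin (d + 1))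
    (hD : ∃ δD CR γR aD : ℝ, 0 < δD ∧ 0 ≤ CR ∧ 0 < γR ∧ 0 < aD ∧
      ∀ i : SfIdx d L, ∀ α₀ : ℝ, 0 < α₀ → (L : ℝ) ^ i.m * α₀ ≤ aD → ∀ A' : Fin (d + 1) → CvX' d L i.m i.kk i.r hL → Matrix mm mm ℂ, (sfInstance d mm (Fin 2 × mm × mm) hL i).Bf.Reg335 c35 α₀ A' →
        HasMaj (CvNorm d L i.m i.kk hL (Fin 2 × mm × mm)) (BlockNorm.ofBlocks (unitTorusGeo L i.kk (cvM d L i.m i.kk hL)) (liftBlk (cvBlk d L i.m i.kk hL ∘ (kingPrV L i.kk i.r (cvM d L i.m i.kk hL))) (Fin 2 × mm × mm))) (idef (pull (liftMap (kingPrV L i.kk i.r (cvM d L i.m i.kk hL)) (Fin 2 × mm × mm))) (pull (liftMap (kingPrV L i.kk i.r (cvM d L i.m i.kk hL)) (Fin 2 × mm × mm))) (cvNVr' d L i.m i.kk i.r hL a (Fin 2 × mm × mm) (TraceFormCoords.tfCoords mm) (fun μ x' => NormedSpace.exp (((((L ^ i.r * L ^ i.kk : ℕ) : ℝ))⁻¹)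 • A' μ x'))) (cvNVr d L i.m i.kk hL a (Fin 2 × mm × mm) (TraceFormCoords.tfCoords mm) (fun μ x => NormedSpace.exp (((((L ^ i.kk : ℕ) : ℝ))⁻¹) • gavgM (Matrix mm mm ℂ) (Fin (d + 1)) (kingPrV L i.kk i.r (cvM d L i.m i.kk hL)) A' μ x)))) (fun y y' => (CR * ((L : ℝ) ^ i.kk) ^ (-γR)) * Real.exp (-(δD * (unitTorusGeo L i.kk (cvM d L i.m i.kk hL)).dist y y'))))
    (α β : Fin (d + 1)) (j j' : Fin 2 × mm × mm) (α' β' : Fin (d + 1)) (j₂ j₂' : Fin 2 × mm × mm) (p : ℝ) :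
    Live (ne2OfRecord₁₁ (sfObjects₈qvr d mm (Fin 2 × mm × mm) a (TraceFormCoords.tfCoords mm) hL μ₁ μ₂ α β j j' α' β' j₂ j₂' c35 p (wQ8D d mm (Fin 2 × mm × mm) a (TraceFormCoords.tfCoords mm) hd hL hL7 ha hc35 (TraceFormCoords.traceForm_eq_tfCoords_dotProduct mm) μ₁ μ₂ hD α β j j' α' β' j₂ j₂' p))) ∧
      N15At (ne2OfRecord₁₁ (sfObjects₈qvr d mm (Fin 2 × mm × mm) a (TraceFormCoords.tfCoords mm) hL μ₁ μ₂ α β j j' α' β' j₂ j₂' c35 p (wQ8D d mm (Fin 2 × mm × mm) a (TraceFormCoords.tfCoords mm) hd hL hL7 ha hc35 (TraceFormCoords.traceForm_eq_tfCoords_dotProduct mm) μ₁ μ₂ hD α β j j' α' β' j₂ j₂' p))) :=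
  live_and_n15At_sfObjects₈qvr_wQ8D d mm (Fin 2 × mm × mm) a (TraceFormCoords.tfCoords mm) hd hL hL7 ha hc35 (TraceFormCoords.traceForm_eq_tfCoords_dotProduct mm) μ₁ μ₂ hD α β j j' α' β' j₂ j₂' p

/-- ★★★ **EXISTENCE FORM** — purely numeric hypotheses + the ONE displayed row: for `d ≥ 1`, odd `L ≥ 7`, `a, c₃₅ > 0`, directions `μ₁ μ₂`, and the two-grid η-defect row of `N_V^R` at the
trace-form coordinates, SOME threshold `w` makes the (P-R) one-propagator literal — Bałaban's WHOLE covariant summand live in the ONE propagator of (3.42)∕(3.48)∕(3.187), all four operator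
entries concrete, covariant averaging in the sandwich, genuine Dirichlet region — satisfy `Live ∧ N15At`. [cite: Balaban1985BackgroundPropagators, Thm 3.1 (3.42) p.397, Thm 3.15 (3.187) p.432 (templates: MODEL level)] -/
theorem exists_live_and_n15At_sfObjects₈qvr_tf (hd : 1 ≤ d) (hL : Odd L ∧ 1 < L) (hL7 : 7 ≤ L) (ha : 0 < a) {c35 : ℝ} (hc35 : 0 < c35) (μ₁ μ₂ : Fin (d + 1))
    (hD : ∃ δD CR γR aD : ℝ, 0 < δD ∧ 0 ≤ CR ∧ 0 < γR ∧ 0 < aD ∧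
      ∀ i : SfIdx d L, ∀ α₀ : ℝ, 0 < α₀ → (L : ℝ) ^ i.m * α₀ ≤ aD → ∀ A' : Fin (d + 1) → CvX' d L i.m i.kk i.r hL → Matrix mm mm ℂ, (sfInstance d mm (Fin 2 × mm × mm) hL i).Bf.Reg335 c35 α₀ A' →
        HasMaj (CvNorm d L i.m i.kk hL (Fin 2 × mm × mm)) (BlockNorm.ofBlocks (unitTorusGeo L i.kk (cvM d L i.m i.kk hL)) (liftBlk (cvBlk d L i.m i.kk hL ∘ (kingPrV L i.kk i.r (cvM d L i.m i.kk hL))) (Fin 2 × mm × mm))) (idef (pull (liftMap (kingPrV L i.kk i.r (cvM d L i.m i.kk hL)) (Fin 2 × mm × mm))) (pull (liftMap (kingPrV L i.kk i.r (cvM d L i.m i.kk hL)) (Fin 2 × mm × mm))) (cvNVr' d L i.m i.kk i.r hL a (Fin 2 × mm × mm) (TraceFormCoords.tfCoords mm) (fun μ x' => NormedSpace.exp (((((L ^ i.r * L ^ i.kk : ℕ) : ℝ))⁻¹) • A' μ x'))) (cvNVr d L i.m i.kk hL a (Fin 2 × mm × mm) (TraceFormCoords.tfCoords mm) (fun μ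 x => NormedSpace.exp (((((L ^ i.kk : ℕ) : ℝ))⁻¹) • gavgM (Matrix mm mm ℂ) (Fin (d + 1)) (kingPrV L i.kk i.r (cvM d L i.m i.kk hL)) A' μ x)))) (fun y y' => (CR * ((L : ℝ) ^ i.kk) ^ (-γR)) * Real.exp (-(δD * (unitTorusGeo L i.kk (cvM d L i.m i.kk hL)).dist y y'))))
    (α β : Fin (d + 1)) (j j' : Fin 2 × mm × mm) (α' β' : Fin (d + 1)) (j₂ j₂' : Fin 2 × mm × mm) (p : ℝ) :
    ∃ w : ℝ, Live (ne2OfRecord₁₁ (sfObjects₈qvr d mm (Fin 2 × mm × mm) a (TraceFormCoords.tfCoords mm) hL μ₁ μ₂ α β j j' α' β' j₂ j₂' c35 p w)) ∧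
      N15At (ne2OfRecord₁₁ (sfObjects₈qvr d mm (Fin 2 × mm × mm) a (TraceFormCoords.tfCoords mm) hL μ₁ μ₂ α β j j' α' β' j₂ j₂' c35 p w)) :=
  exists_live_and_n15At_sfObjects₈qvr_of_defectRow d mm (Fin 2 × mm × mm) a (TraceFormCoords.tfCoords mm) hd hL hL7 ha hc35 (TraceFormCoords.traceForm_eq_tfCoords_dotProduct mm) μ₁ μ₂ hD α β j j' α' β' j₂ j₂' p

end Tf

end Summit.QuantumFields.YangMills.BalabanUVNodes.N15.SiteLayerSf

end
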